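import Summits.MatrixMultiplication.MatrixMultiplication.Theorems.SoloBlindRelativeRestriction
import Literature.Barriers.MatrixMultiplication.UniversalMethodBarrierDegenerationPow
import Literature.Barriers.MatrixMultiplication.UniversalMethodBarrierAsymptoticRank
import Literature.Computability.AlgebraicComplexity.AsymptoticRankMultiples
import HarnessLib

/-!
# The relative door under degeneration: `⟨m⟩ ⊠ S ⊵ X ⊠ S` forces `R̃(X) ≤ m`

`Summits/MatrixMultiplication/MatrixMultiplication/Theorems` (soloist file, blind arm).  The companion
`SoloBlindRelativeRestriction.lean` proved the RESTRICTION form of the relative (common-factor) bound: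
`⟨m⟩ ⊠ S ≥ X ⊠ S` with `S ≥ ⟨1⟩` gives `R̃(X) ≤ m`.  This file proves the DEGENERATION form, which is
the one relevant to border-rank identities (`X ⊠ S ⊴ ⟨m⟩ ⊠ S`, i.e. `bR`-type savings with a common
factor `S` that is paid for only once):

* `soloRelDeg_pow_le_rankTerm` — `R̃(t)^k ≤ R((t^{⊠k})^{⊠(N+1)})^{1/(N+1)}` for `k ≥ 1` and every
  `N` (termwise form of the easy half `R̃(t)^k ≤ R̃(t^{⊠k})`, which the tree already has as
  `asymptoticRank_pow_le_kroneckerPow`; we only need the termwise bound under `le_ciInf`).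
* `soloRelDeg_step`, `soloRelDeg_iterate` — from `⟨m⟩ ⊠ S ⊵ X ⊠ S`:
  `⟨m⟩^{⊠n} ⊠ S ⊵ X^{⊠n} ⊠ S` for every `n` (transitivity and Kronecker monotonicity of `⊵`,
  Alman 2021 §2.4 as formalised in `UniversalMethodBarrierDegenerationPow.lean`).
* `asymptoticRank_le_of_relativeDegeneration` — **`⟨m⟩ ⊠ S ⊵ X ⊠ S`, `S ≥ ⟨1⟩ ⟹ R̃(X) ≤ m`**
  (over a field): `R̃(X)^n ≤ R̃(X^{⊠n}) ≤ R̃(X^{⊠n} ⊠ S) ≤ R̃(⟨m⟩^{⊠n} ⊠ S) ≤ R̃(⟨m^n⟩ ⊠ S) ≤ m^n R̃(S)`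
  for all `n`, by `⊵`-monotonicity of `R̃` (`asymptoticRank_le_of_polyDegeneratesTo`) and
  `R̃(⟨f⟩ ⊠ s) ≤ f R̃(s)` (`asymptoticRank_multiple_le`); the orders of the degenerations play no role.
* `asymptoticRank_pow_le_of_relativeDegeneration` — for one tensor `T ≥ ⟨1⟩` and `d ≥ 1`:
  `⟨m⟩ ⊠ T^{⊠j} ⊵ T^{⊠d} ⊠ T^{⊠j}` ("`T^{⊠(j+d)} ⊴ m · T^{⊠j}`") gives `R̃(T)^d ≤ m`;
  `asymptoticRank_cwTensor_two_pow_le_of_relativeDegeneration` — the case `T = T_{cw,2}`, where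
  `m = 3^d` would give `R̃(T_{cw,2}) = 3` and hence `ω = 2`.

Informal placement (not formalised): for `T = T_{cw,2}` the tight value `m = 3^d` is excluded for every
`j` by the support obstruction of the soloist notes (§16–17), while Koszul flattenings give the lower
bounds `m ≥ 14` for `(j,d) = (1,2)` and `m ≥ 40` for `(1,3)`.

## References

* J. Alman, *Limits on the Universal Method for Matrix Multiplication*, Theory of Computing 17 (2021),
  §2.4 (degenerations; `R̃` is `⊵`-monotone). [Alman2021]
* J. Alman, R. Duan, V. Vassilevska Williams, Y. Xu, Z. Xu, R. Zhou, SODA 2025, arXiv:2404.16349,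
  §3.2 (`R̃` of direct sums). [AlmanDuanVassilevskaWilliamsXuXuZhou2025]
* M. Christandl, P. Vrana, J. Zuiddam, *Universal points in the asymptotic spectrum of tensors*,
  J. Amer. Math. Soc. 36 (2023), §1.1 (`R̃` as an infimum). [ChristandlVranaZuiddam2023]
-/

noncomputable section

open scoped BigOperators Polynomial

namespace Summit.MatrixMultiplication.MatrixMultiplication.Theorems

open Literature.Computability.AlgebraicComplexity
open Literature.Barriers.MatrixMultiplication

universe u

/-! ## The degeneration chain `⟨m⟩^{⊠n} ⊠ S ⊵ X^{⊠n} ⊠ S` (any commutative semiring) -/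

section Chain

variable {K : Type u} [CommSemiring K]
variable {ι κ μ ι' κ' μ' : Type*} [Fintype ι] [Fintype κ] [Fintype μ] [Fintype ι'] [Fintype κ']
  [Fintype μ'] [DecidableEq ι] [DecidableEq κ] [DecidableEq μ] [DecidableEq ι'] [DecidableEq κ']
  [DecidableEq μ']

omit [Fintype ι'] [Fintype κ'] [Fintype μ'] [DecidableEq ι'] [DecidableEq κ'] [DecidableEq μ'] in
/-- Zeroth Kronecker powers are all the `1 × 1 × 1` tensor `1`: `t^{⊠0} ≥ s^{⊠0}`. -/
theorem soloRelDeg_kroneckerPow_zero_restrictsTo (t : ι → κ → μ → K) (s : ι' → κ' → μ' → K) :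
    TensorRestrictsTo (kroneckerPow t 0) (kroneckerPow s 0) := by
  have h := tensorRestrictsTo_precomp (kroneckerPow t 0) (fun _ : Fin 0 → ι' => fun i : Fin 0 => i.elim0)
    (fun _ : Fin 0 → κ' => fun i : Fin 0 => i.elim0) (fun _ : Fin 0 → μ' => fun i : Fin 0 => i.elim0)
  have key : (fun (a : Fin 0 → ι') (b : Fin 0 → κ') (c : Fin 0 → μ') => kroneckerPow t 0
      ((fun _ : Fin 0 → ι' => fun i : Fin 0 => (i.elim0 : ι)) a)
      ((fun _ : Fin 0 → κ' => fun i : Fin 0 => (i.elim0 : κ)) b)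
      ((fun _ : Fin 0 → μ' => fun i : Fin 0 => (i.elim0 : μ)) c)) = kroneckerPow s 0 := by
    funext a b c
    simp
  rw [key] at h
  exact h

/-- **One relative step under degeneration**: from `⟨m⟩ ⊠ S ⊵ X ⊠ S`,
`⟨m⟩ ⊠ (X^{⊠n} ⊠ S) ⊵ X^{⊠(n+1)} ⊠ S` (reassociate, commute, degenerate in the middle, merge the
powers). -/
theorem soloRelDeg_step (X : ι → κ → μ → K) (S : ι' → κ' → μ' → K) (m : ℕ)
    (h : PolyDegeneratesTo (kroneckerTensor (unitTensor K m) S) (kroneckerTensor X S)) (n : ℕ) :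
    PolyDegeneratesTo (kroneckerTensor (unitTensor K m) (kroneckerTensor (kroneckerPow X n) S))
      (kroneckerTensor (kroneckerPow X (n + 1)) S) := by
  -- `⟨m⟩ ⊠ (Xⁿ ⊠ S) ≥ (⟨m⟩ ⊠ Xⁿ) ⊠ S ≥ (Xⁿ ⊠ ⟨m⟩) ⊠ S ≥ Xⁿ ⊠ (⟨m⟩ ⊠ S)`
  have h1 : TensorRestrictsTo (kroneckerTensor (unitTensor K m) (kroneckerTensor (kroneckerPow X n) S))
      (kroneckerTensor (kroneckerPow X n) (kroneckerTensor (unitTensor K m) S)) :=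
    ((tensorRestrictsTo_kronecker_assoc K (unitTensor K m) (kroneckerPow X n) S).trans
      ((tensorRestrictsTo_kronecker_comm K (unitTensor K m) (kroneckerPow X n)).kronecker
        (TensorRestrictsTo.refl S))).trans
      (tensorRestrictsTo_kronecker_assoc' K (kroneckerPow X n) (unitTensor K m) S)
  -- `Xⁿ ⊠ (⟨m⟩ ⊠ S) ⊵ Xⁿ ⊠ (X ⊠ S)`
  have h2 : PolyDegeneratesTo (kroneckerTensor (kroneckerPow X n) (kroneckerTensor (unitTensor K m) S))
      (kroneckerTensor (kroneckerPow X n) (kroneckerTensor X S)) :=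
    (TensorRestrictsTo.refl (kroneckerPow X n)).polyDegeneratesTo.kronecker h
  -- `Xⁿ ⊠ (X ⊠ S) ≥ (Xⁿ ⊠ X) ⊠ S ≥ (Xⁿ ⊠ X¹) ⊠ S ≥ X^{n+1} ⊠ S`
  have h3 : TensorRestrictsTo (kroneckerTensor (kroneckerPow X n) (kroneckerTensor X S))
      (kroneckerTensor (kroneckerPow X (n + 1)) S) :=
    ((tensorRestrictsTo_kronecker_assoc K (kroneckerPow X n) X S).trans
      (((TensorRestrictsTo.refl (kroneckerPow X n)).kronecker
        (soloRel_restrictsTo_kroneckerPow_one X)).kronecker (TensorRestrictsTo.refl S))).trans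
      ((tensorMonRestrictsTo_kroneckerPow_add' X n 1).tensorRestrictsTo.kronecker
        (TensorRestrictsTo.refl S))
  exact (h1.trans_polyDegeneratesTo h2).trans_restrictsTo h3

/-- **The relative degeneration chain**: `⟨m⟩ ⊠ S ⊵ X ⊠ S` implies `⟨m⟩^{⊠n} ⊠ S ⊵ X^{⊠n} ⊠ S`
for every `n` — the common factor `S` is never powered. -/
theorem soloRelDeg_iterate (X : ι → κ → μ → K) (S : ι' → κ' → μ' → K) (m : ℕ)
    (h : PolyDegeneratesTo (kroneckerTensor (unitTensor K m) S) (kroneckerTensor X S)) :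
    ∀ n : ℕ, PolyDegeneratesTo (kroneckerTensor (kroneckerPow (unitTensor K m) n) S)
      (kroneckerTensor (kroneckerPow X n) S)
  | 0 => ((soloRelDeg_kroneckerPow_zero_restrictsTo (unitTensor K m) X).kronecker
      (TensorRestrictsTo.refl S)).polyDegeneratesTo
  | n + 1 => by
    -- `⟨m⟩^{n+1} ⊠ S ≥ (⟨m⟩ ⊠ ⟨m⟩ⁿ) ⊠ S ≥ ⟨m⟩ ⊠ (⟨m⟩ⁿ ⊠ S) ⊵ ⟨m⟩ ⊠ (Xⁿ ⊠ S) ⊵ X^{n+1} ⊠ S`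
    have h1 : TensorRestrictsTo (kroneckerPow (unitTensor K m) (n + 1))
        (kroneckerTensor (unitTensor K m) (kroneckerPow (unitTensor K m) n)) := by
      rw [kroneckerTensor_kroneckerPow_eq]
      exact tensorRestrictsTo_precomp _ _ _ _
    have h2 : TensorRestrictsTo (kroneckerTensor (kroneckerPow (unitTensor K m) (n + 1)) S)
        (kroneckerTensor (unitTensor K m) (kroneckerTensor (kroneckerPow (unitTensor K m) n) S)) :=
      (h1.kronecker (TensorRestrictsTo.refl S)).trans
        (tensorRestrictsTo_kronecker_assoc' K (unitTensor K m) (kroneckerPow (unitTensor K m) n) S)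
    have h3 : PolyDegeneratesTo
        (kroneckerTensor (unitTensor K m) (kroneckerTensor (kroneckerPow (unitTensor K m) n) S))
        (kroneckerTensor (unitTensor K m) (kroneckerTensor (kroneckerPow X n) S)) :=
      (TensorRestrictsTo.refl (unitTensor K m)).polyDegeneratesTo.kronecker
        (soloRelDeg_iterate X S m h n)
    exact ((h2.trans_polyDegeneratesTo h3).trans (soloRelDeg_step X S m h n))

end Chain

/-! ## Asymptotic rank consequences (over a field; `K` and the index types in `Type`, the universes of
`asymptoticRank_multiple_le`) -/

section AsymptoticRank

variable {K : Type} [Field K]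
variable {ι κ μ ι' κ' μ' : Type} [Fintype ι] [Fintype κ] [Fintype μ] [Fintype ι'] [Fintype κ']
  [Fintype μ'] [DecidableEq ι] [DecidableEq κ] [DecidableEq μ] [DecidableEq ι'] [DecidableEq κ']
  [DecidableEq μ']

omit [Fintype ι'] [Fintype κ'] [Fintype μ'] [DecidableEq ι] [DecidableEq κ] [DecidableEq μ] [DecidableEq ι']
  [DecidableEq κ'] [DecidableEq μ'] in
/-- **`R̃(t)^k ≤ R((t^{⊠k})^{⊠(N+1)})^{1/(N+1)}`** for `k ≥ 1` and every `N`: since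
`R̃(t) ≤ R(t^{⊠(N+1)k})^{1/((N+1)k)}`, `R̃(t)^k` is below the `N`-th term of the infimum defining
`R̃(t^{⊠k})` (termwise form; combine with `le_ciInf`). -/
theorem soloRelDeg_pow_le_rankTerm (t : ι → κ → μ → K) {k : ℕ} (hk : 0 < k) (N : ℕ) :
    asymptoticRank t ^ k ≤
      (tensorRank (kroneckerPow (kroneckerPow t k) (N + 1)) : ℝ) ^ ((N : ℝ) + 1)⁻¹ := by
  have h0 : 0 ≤ asymptoticRank t := asymptoticRank_nonneg _
  have hpos : 0 < (N + 1) * k := Nat.mul_pos (Nat.succ_pos N) hk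
  have h1 := asymptoticRank_le_rpow t hpos
  have hR : ((tensorRank (kroneckerPow t ((N + 1) * k)) : ℝ)) =
      tensorRank (kroneckerPow (kroneckerPow t k) (N + 1)) := by
    exact_mod_cast tensorRank_kroneckerPow_mul t (N + 1) k
  have hk0 : (k : ℝ) ≠ 0 := by exact_mod_cast hk.ne'
  have hN0 : ((N : ℝ) + 1) ≠ 0 := by positivity
  have hexp : ((((N + 1) * k : ℕ) : ℝ))⁻¹ * (k : ℝ) = ((N : ℝ) + 1)⁻¹ := by
    push_cast
    field_simp
  calc asymptoticRank t ^ k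
      ≤ (((tensorRank (kroneckerPow t ((N + 1) * k)) : ℝ)) ^ ((((N + 1) * k : ℕ) : ℝ))⁻¹) ^ k :=
        pow_le_pow_left₀ h0 h1 k
    _ = ((tensorRank (kroneckerPow t ((N + 1) * k)) : ℝ)) ^
          (((((N + 1) * k : ℕ) : ℝ))⁻¹ * (k : ℝ)) := by
        rw [Real.rpow_mul (Nat.cast_nonneg _), Real.rpow_natCast]
    _ = ((tensorRank (kroneckerPow (kroneckerPow t k) (N + 1)) : ℝ)) ^ (((N : ℝ) + 1)⁻¹) := by
        rw [hexp, hR]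

/-- **The relative door under degeneration.**  If `S ≥ ⟨1⟩` and `⟨m⟩ ⊠ S ⊵ X ⊠ S` (the direct sum
of `m` copies of `S` degenerates to `X ⊠ S`), then `R̃(X) ≤ m`: for every `n ≥ 1`,
`R̃(X)^n ≤ R̃(X^{⊠n}) ≤ R̃(X^{⊠n} ⊠ S) ≤ R̃(⟨m⟩^{⊠n} ⊠ S) ≤ R̃(⟨m^n⟩ ⊠ S) ≤ m^n · R̃(S)`. -/
theorem asymptoticRank_le_of_relativeDegeneration (X : ι → κ → μ → K) (S : ι' → κ' → μ' → K)
    (m : ℕ) (hS : TensorRestrictsTo S (unitTensor K 1))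
    (h : PolyDegeneratesTo (kroneckerTensor (unitTensor K m) S) (kroneckerTensor X S)) :
    asymptoticRank X ≤ m := by
  have key : ∀ n : ℕ, 0 < n → asymptoticRank X ^ n ≤ (m : ℝ) ^ n * asymptoticRank S := by
    intro n hn
    have hXS : TensorRestrictsTo (kroneckerTensor (kroneckerPow X n) S) (kroneckerPow X n) :=
      ((TensorRestrictsTo.refl (kroneckerPow X n)).kronecker hS).trans
        (soloRel_kronecker_unitTensor_one_restrictsTo (kroneckerPow X n))
    calc asymptoticRank X ^ n
        ≤ asymptoticRank (kroneckerPow X n) := le_ciInf fun N => soloRelDeg_pow_le_rankTerm X hn N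
      _ ≤ asymptoticRank (kroneckerTensor (kroneckerPow X n) S) :=
          asymptoticRank_le_of_polyDegeneratesTo hXS.polyDegeneratesTo
      _ ≤ asymptoticRank (kroneckerTensor (kroneckerPow (unitTensor K m) n) S) :=
          asymptoticRank_le_of_polyDegeneratesTo (soloRelDeg_iterate X S m h n)
      _ ≤ asymptoticRank (kroneckerTensor (unitTensor K (m ^ n)) S) :=
          asymptoticRank_le_of_polyDegeneratesTo
            (((unitTensor_pow_restrictsTo (K := K) m n).kronecker
              (TensorRestrictsTo.refl S)).polyDegeneratesTo)
      _ ≤ ((m ^ n : ℕ) : ℝ) * asymptoticRank S := asymptoticRank_multiple_le (K := K) (f := m ^ n) (s := S)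
      _ = (m : ℝ) ^ n * asymptoticRank S := by push_cast; ring
  have hX0 : 0 ≤ asymptoticRank X := asymptoticRank_nonneg _
  have hS0 : 0 ≤ asymptoticRank S := asymptoticRank_nonneg _
  by_contra hlt
  rw [not_le] at hlt
  rcases Nat.eq_zero_or_pos m with rfl | hm
  · have h1 := key 1 one_pos
    simp only [pow_one, Nat.cast_zero, zero_mul] at h1
    exact absurd (hlt.trans_le h1) (by simp)
  · have hm0 : (0 : ℝ) < m := by exact_mod_cast hm
    set q : ℝ := asymptoticRank X / m with hq
    have hq1 : 1 < q := by rw [hq, lt_div_iff₀ hm0, one_mul]; exact hlt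
    have hqn : ∀ n : ℕ, 0 < n → q ^ n ≤ asymptoticRank S := by
      intro n hn
      rw [hq, div_pow, div_le_iff₀ (pow_pos hm0 n), mul_comm]
      exact key n hn
    obtain ⟨n, hn⟩ := pow_unbounded_of_one_lt (asymptoticRank S) hq1
    have : q ^ n ≤ q ^ (n + 1) := pow_le_pow_right₀ hq1.le (Nat.le_succ n)
    exact absurd ((hn.trans_le this).trans_le (hqn (n + 1) (Nat.succ_pos n))) (lt_irrefl _)

/-- **Relative self-bounding under degeneration for one tensor**: if `T ≥ ⟨1⟩`, `d ≥ 1` and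
`⟨m⟩ ⊠ T^{⊠j} ⊵ T^{⊠d} ⊠ T^{⊠j}` ("`T^{⊠(j+d)}` is a degeneration of `m` copies of `T^{⊠j}`"),
then `R̃(T)^d ≤ m`. -/
theorem asymptoticRank_pow_le_of_relativeDegeneration (T : ι → κ → μ → K) (j d m : ℕ)
    (hd : 1 ≤ d) (hT : TensorRestrictsTo T (unitTensor K 1))
    (h : PolyDegeneratesTo (kroneckerTensor (unitTensor K m) (kroneckerPow T j))
      (kroneckerTensor (kroneckerPow T d) (kroneckerPow T j))) :
    asymptoticRank T ^ d ≤ m := by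
  -- `T^{⊠j} ≥ ⟨1⟩^{⊠j} ≥ ⟨1⟩`
  have hS : TensorRestrictsTo (kroneckerPow T j) (unitTensor K 1) := by
    refine (hT.kroneckerPow j).trans ?_
    have := tensorRestrictsTo_precomp (kroneckerPow (unitTensor K 1) j) (fun a : Fin 1 => fun _ => a)
      (fun b : Fin 1 => fun _ => b) (fun c : Fin 1 => fun _ => c)
    have key : (fun a b c => kroneckerPow (unitTensor K 1) j (fun _ : Fin j => a) (fun _ => b)
        (fun _ => c)) = unitTensor K 1 := by
      funext a b c
      rw [Subsingleton.elim a 0, Subsingleton.elim b 0, Subsingleton.elim c 0]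
      simp
    rw [key] at this
    exact this
  exact (le_ciInf fun N => soloRelDeg_pow_le_rankTerm T hd N :
      asymptoticRank T ^ d ≤ asymptoticRank (kroneckerPow T d)).trans
    (asymptoticRank_le_of_relativeDegeneration _ _ m hS h)

/-- **The relative door for `T_{cw,2}` under degeneration**: a degeneration
`⟨m⟩ ⊠ T_{cw,2}^{⊠j} ⊵ T_{cw,2}^{⊠d} ⊠ T_{cw,2}^{⊠j}` (`m` copies of `T_{cw,2}^{⊠j}` degenerate to
`T_{cw,2}^{⊠(d+j)}`), for any `j` and `d ≥ 1`, gives `R̃(T_{cw,2})^d ≤ m` over any field.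
(`m = 3^d` would mean `R̃(T_{cw,2}) = 3`, whence `ω = 2` over `ℂ`; restrictions are degenerations, so
this contains `asymptoticRank_cwTensor_two_pow_le_of_relativeRestriction` over fields.) -/
theorem asymptoticRank_cwTensor_two_pow_le_of_relativeDegeneration (j d m : ℕ) (hd : 1 ≤ d)
    (h : PolyDegeneratesTo (kroneckerTensor (unitTensor K m) (kroneckerPow (cwTensor K 2) j))
      (kroneckerTensor (kroneckerPow (cwTensor K 2) d) (kroneckerPow (cwTensor K 2) j))) :
    asymptoticRank (cwTensor K 2) ^ d ≤ m :=
  asymptoticRank_pow_le_of_relativeDegeneration _ j d m hd cwTensor_two_restrictsTo_unitTensor_one h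

end AsymptoticRank

end Summit.MatrixMultiplication.MatrixMultiplication.Theorems

end
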